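import Summits.Ventures.CertifiedManyBodySolver.Downfold.EmeryBoxesTl2201K26ThermalCapWord
import Literature.MathematicalPhysics.QuantumLattice.EmeryThreeBandThermalMarkovCap
import HarnessLib

/-!
# ENTROPY-RESOLVED `T > 0` CAP WORD on `emeryBoxTl2201K26` (level εp = -91/10): the four kgp1x5 corner sector tables read through the Markov (conditional-entropy)
# law tighten hubbard-downfold-mod-4's cap word `38.9833·β + 6 log 2 → maxᵢ log Fᵢ(β)` (`38.9833·β + log 15 = 38.9833·β + 2.7081` as β → ∞); hubbard-box-p1 g24, by value

Venture CertifiedManyBodySolver, cell `pub/hubbard-downfold` (S1 = ROUTER) × crew hubbard-fast S2 (ii) × (iv) «T > 0 × multi-band» (D-0096 (ii)); seat hubbard-box-p1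
(row «Lipschitz / joint laws in (U, μ) of certified objects; box ⊂ ∪ cells ⇒ word»), by value for the word owner hubbard-downfold-mod-4 (COVERAGE BATCH 4 cap words).
Namespace `Summit.Ventures.CertifiedManyBodySolver.Downfold`. Same construction as `EmeryBoxes<X>ThermalMarkovCapBoxp1` (g22) / §3–§5 of `EmeryBoxes<X>ThermalCapRetiltMarkovBoxp1`
(g23). NO RE-TILT SECTION: for this object all four corner certificates of the cap word sit at the SAME tilt `μ = (-91/10, -91/10, -91/10, -91/10)` = the level εp,
so the sector-wise re-tilt of `EmeryThreeBandCuO4CertificateRetilt` (shift `cᵢ = εp − μᵢ = 0`) is the identity and the flat cap constant `6237333/160000 = 38.9833312`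
of `emeryBoxTl2201K26_pressureCap_m91o10` is already the re-tilted one; only the entropy constant moves.

INPUTS BY NAME: `EmeryBoxesTl2201K26ThermalCapWord` (cap word `emeryBoxTl2201K26_pressureCap_m91o10`, corners `tl2201K26Corner`, `tl2201K26_lowerCorner`, box entries
`tl2201K26Emery_*`); `EmeryBoxesTl2201K26FloorWord` (table identities `tl2201K26Floor_tau/ups/nu i`); the kgp1x5 sector tables `kgp1x5_<c>_table` / `_sigma`
(Tl2201x_c0_ll_mum91o10, Tl2201x_c1_hl_mum91o10, Tl2201x_c2_lh_mum91o10, Tl2201x_c3_hh_mum91o10; device hubbard-box-p2, run by hubbard-downfold-mod-4); the Literature law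
`EmeryThreeBandThermalMarkovCap` (`emeryCellPressure_le_log_of_gpSectorFloors`: `P_cell ≤ log max_{n≤4} Σ_{j≤6} C(6,j)·e^{−(β/2)·q(j+n)}` from sector floors `q` of the
plus, here `q = σᵢ` itself); the box door `holdsOn_emeryCellPressureCap_of_cornerCaps` (`EmeryThermalSeam`).

ENTROPY-RESOLVED WORD BY VALUE [float, 4 dp, `gen-g23/gen_retilt_markov_box.py`; exact rationals inside the theorems]: flat `38.9833·β + 6 log 2` (mod-4) vs Markov `maxᵢ log Fᵢ(β)`:
| β (1/eV) | flat (mod-4) | Markov | gain (nats/CuO₂) |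
|---|---|---|---|
| 0.05 | 6.1080 | 5.9574 | 0.1507 |
| 0.1 | 8.0572 | 7.7766 | 0.2806 |
| 0.5 | 23.6505 | 22.7974 | 0.8532 |
| 1 | 43.1422 | 42.0685 | 1.0737 |
| 5 | 199.0755 | 197.7943 | 1.2812 |
| 10 | 393.9922 | 392.6228 | 1.3694 |
| 40 | 1563.4921 | 1562.0421 | 1.4500 |
As β → ∞: `maxᵢ log Fᵢ(β) = 38.9833·β + log 15 + o(1)` (corner 0, minimum in sector k = 8, shield offset n = 4; all four corners share `min σ = -6237333/80000`);
asymptotic gain `6 log 2 − log 15 = 1.4508` (the finite-β gains above are smaller because each corner's next sector lies close to its minimum). HONEST FRAMING: CERTIFIED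
inequalities on a SCREENING-GRADE object (U-slice / companion per EMERY-LINE; box ends [float]/DFT with locators in the router's BOXES files); the Markov reading moves only
the CONSTANT (of the `6 log 2 = 4.1589`), not the β-slope; the cap−floor slope mismatch of the T = 0 words is unchanged — thermal scales are NOT resolved; grand-canonical
statements at a stated level; no phase word; no router number moves. WHAT-THIS-IS-NOT: a certificate or a number of record — a reading of existing kernel tables through
one law (zero kit).
-/

noncomputable section

namespace Summit.Ventures.CertifiedManyBodySolver.Downfold

open NonemptyInterval Matrix Finset Literature.Probability.LatticeModels
open Literature.MathematicalPhysics.QuantumLattice Literature.Computation.Certificates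
open Summit.Ventures.CertifiedManyBodySolver.Certificates OccupationCode ClusterLowerBound
open scoped BigOperators ComplexOrder

/-- Each Markov sum is positive (its `j = 0` term is an exponential). [folklore] -/
private theorem sum_choose_exp_pos' (g : ℕ → ℝ) : 0 < ∑ j ∈ Finset.range 7, ((Nat.choose 6 j : ℕ) : ℝ) * Real.exp (g j) :=
  lt_of_lt_of_le (mul_pos (by norm_num) (Real.exp_pos (g 0)))
    (Finset.single_le_sum (f := fun j => ((Nat.choose 6 j : ℕ) : ℝ) * Real.exp (g j)) (fun j _ => by positivity)
      (Finset.mem_range.2 (by norm_num)))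

/-! ## §1 The four sector tables in dictionary form -/

/-- **Sector table, corner 0** (tilt `μ = -91/10`): the kernel table `kgp1x5_Tl2201x_c0_ll_mum91o10_table` in dictionary form, `θ = emeryLine cuprateSigns (tl2201K26Corner 0) + (-91/10)·levelDir`.
[cite: KullEtAl2024, §5.3] -/
theorem tl2201K26Floor_table0 : ∀ k ≤ 10, ((kgp1x5_Tl2201x_c0_ll_mum91o10_sigma k : ℚ) : ℝ) ≤
    groundEnergy (hubbardOpenBoxGP 1 5 (plusTau (emeryLine cuprateSigns (tl2201K26Corner 0) + (-91/10 : ℝ) • levelDir) 2)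
      (plusUps (emeryLine cuprateSigns (tl2201K26Corner 0) + (-91/10 : ℝ) • levelDir) 2)
      (plusNu (emeryLine cuprateSigns (tl2201K26Corner 0) + (-91/10 : ℝ) • levelDir) 2)) k := by
  intro k hk
  have h := kgp1x5_Tl2201x_c0_ll_mum91o10_table k hk
  rw [tl2201K26Floor_tau0, tl2201K26Floor_ups0, tl2201K26Floor_nu0] at h
  exact h

/-- **Sector table, corner 1** (tilt `μ = -91/10`): the kernel table `kgp1x5_Tl2201x_c1_hl_mum91o10_table` in dictionary form, `θ = emeryLine cuprateSigns (tl2201K26Corner 1) + (-91/10)·levelDir`.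
[cite: KullEtAl2024, §5.3] -/
theorem tl2201K26Floor_table1 : ∀ k ≤ 10, ((kgp1x5_Tl2201x_c1_hl_mum91o10_sigma k : ℚ) : ℝ) ≤
    groundEnergy (hubbardOpenBoxGP 1 5 (plusTau (emeryLine cuprateSigns (tl2201K26Corner 1) + (-91/10 : ℝ) • levelDir) 2)
      (plusUps (emeryLine cuprateSigns (tl2201K26Corner 1) + (-91/10 : ℝ) • levelDir) 2)
      (plusNu (emeryLine cuprateSigns (tl2201K26Corner 1) + (-91/10 : ℝ) • levelDir) 2)) k := by
  intro k hk
  have h := kgp1x5_Tl2201x_c1_hl_mum91o10_table k hk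
  rw [tl2201K26Floor_tau1, tl2201K26Floor_ups1, tl2201K26Floor_nu1] at h
  exact h

/-- **Sector table, corner 2** (tilt `μ = -91/10`): the kernel table `kgp1x5_Tl2201x_c2_lh_mum91o10_table` in dictionary form, `θ = emeryLine cuprateSigns (tl2201K26Corner 2) + (-91/10)·levelDir`.
[cite: KullEtAl2024, §5.3] -/
theorem tl2201K26Floor_table2 : ∀ k ≤ 10, ((kgp1x5_Tl2201x_c2_lh_mum91o10_sigma k : ℚ) : ℝ) ≤
    groundEnergy (hubbardOpenBoxGP 1 5 (plusTau (emeryLine cuprateSigns (tl2201K26Corner 2) + (-91/10 : ℝ) • levelDir) 2)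
      (plusUps (emeryLine cuprateSigns (tl2201K26Corner 2) + (-91/10 : ℝ) • levelDir) 2)
      (plusNu (emeryLine cuprateSigns (tl2201K26Corner 2) + (-91/10 : ℝ) • levelDir) 2)) k := by
  intro k hk
  have h := kgp1x5_Tl2201x_c2_lh_mum91o10_table k hk
  rw [tl2201K26Floor_tau2, tl2201K26Floor_ups2, tl2201K26Floor_nu2] at h
  exact h

/-- **Sector table, corner 3** (tilt `μ = -91/10`): the kernel table `kgp1x5_Tl2201x_c3_hh_mum91o10_table` in dictionary form, `θ = emeryLine cuprateSigns (tl2201K26Corner 3) + (-91/10)·levelDir`.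
[cite: KullEtAl2024, §5.3] -/
theorem tl2201K26Floor_table3 : ∀ k ≤ 10, ((kgp1x5_Tl2201x_c3_hh_mum91o10_sigma k : ℚ) : ℝ) ≤
    groundEnergy (hubbardOpenBoxGP 1 5 (plusTau (emeryLine cuprateSigns (tl2201K26Corner 3) + (-91/10 : ℝ) • levelDir) 2)
      (plusUps (emeryLine cuprateSigns (tl2201K26Corner 3) + (-91/10 : ℝ) • levelDir) 2)
      (plusNu (emeryLine cuprateSigns (tl2201K26Corner 3) + (-91/10 : ℝ) • levelDir) 2)) k := by
  intro k hk
  have h := kgp1x5_Tl2201x_c3_hh_mum91o10_table k hk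
  rw [tl2201K26Floor_tau3, tl2201K26Floor_ups3, tl2201K26Floor_nu3] at h
  exact h

/-! ## §2 The four entropy-resolved corner caps at level εp = -91/10 (every corner certificate is already at the level: no re-tilt) -/

/-- **CORNER 0, entropy-resolved cap** at level -91/10 (every β ≥ 0): `P_cell ≤ log max_{n≤4} Σ_{j≤6} C(6,j)·e^{−(β/2)·q_0(j+n)}`, `q_0(k) = σ_0(k)` (the corner's own kgp1x5 table, §1)
(as β → ∞: `38.9833·β + log 15`, minimum in sector(s) k = [8]). [cite: PoulinHastings2011, eqs. (3)–(8)] [cite: Israel1979, Thm. I.2.4] -/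
theorem emeryBoxTl2201K26_corner0_pressureCap_m91o10_markov {β : ℝ} (hβ : 0 ≤ β) :
    emeryCellPressure β (emeryLine cuprateSigns (tl2201K26Corner 0) + ((-91/10 : ℚ) : ℝ) • levelDir) ≤
      Real.log ((Finset.range 5).sup' ⟨0, by simp⟩ fun n => ∑ j ∈ Finset.range 7, ((Nat.choose 6 j : ℕ) : ℝ) *
        Real.exp (-(β / 2 * ((kgp1x5_Tl2201x_c0_ll_mum91o10_sigma (j + n) : ℚ) : ℝ)))) := by
  rw [show ((-91/10 : ℚ) : ℝ) = (-91/10 : ℝ) by norm_num]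
  refine emeryCellPressure_le_log_of_gpSectorFloors _ (M := 2) two_pos hβ _ tl2201K26Floor_table0 ?_ fun n hn => ?_
  · exact lt_of_lt_of_le (sum_choose_exp_pos' _) (Finset.le_sup' (fun n => ∑ j ∈ Finset.range 7, ((Nat.choose 6 j : ℕ) : ℝ) *
        Real.exp (-(β / 2 * ((kgp1x5_Tl2201x_c0_ll_mum91o10_sigma (j + n) : ℚ) : ℝ)))) (Finset.mem_range.2 (by norm_num : 0 < 5)))
  · exact Finset.le_sup' (fun n => ∑ j ∈ Finset.range 7, ((Nat.choose 6 j : ℕ) : ℝ) *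
        Real.exp (-(β / 2 * ((kgp1x5_Tl2201x_c0_ll_mum91o10_sigma (j + n) : ℚ) : ℝ)))) (Finset.mem_range.2 (by omega))

/-- **CORNER 1, entropy-resolved cap** at level -91/10 (every β ≥ 0): `P_cell ≤ log max_{n≤4} Σ_{j≤6} C(6,j)·e^{−(β/2)·q_1(j+n)}`, `q_1(k) = σ_1(k)` (the corner's own kgp1x5 table, §1)
(as β → ∞: `38.9833·β + log 15`, minimum in sector(s) k = [8]). [cite: PoulinHastings2011, eqs. (3)–(8)] [cite: Israel1979, Thm. I.2.4] -/
theorem emeryBoxTl2201K26_corner1_pressureCap_m91o10_markov {β : ℝ} (hβ : 0 ≤ β) :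
    emeryCellPressure β (emeryLine cuprateSigns (tl2201K26Corner 1) + ((-91/10 : ℚ) : ℝ) • levelDir) ≤
      Real.log ((Finset.range 5).sup' ⟨0, by simp⟩ fun n => ∑ j ∈ Finset.range 7, ((Nat.choose 6 j : ℕ) : ℝ) *
        Real.exp (-(β / 2 * ((kgp1x5_Tl2201x_c1_hl_mum91o10_sigma (j + n) : ℚ) : ℝ)))) := by
  rw [show ((-91/10 : ℚ) : ℝ) = (-91/10 : ℝ) by norm_num]
  refine emeryCellPressure_le_log_of_gpSectorFloors _ (M := 2) two_pos hβ _ tl2201K26Floor_table1 ?_ fun n hn => ?_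
  · exact lt_of_lt_of_le (sum_choose_exp_pos' _) (Finset.le_sup' (fun n => ∑ j ∈ Finset.range 7, ((Nat.choose 6 j : ℕ) : ℝ) *
        Real.exp (-(β / 2 * ((kgp1x5_Tl2201x_c1_hl_mum91o10_sigma (j + n) : ℚ) : ℝ)))) (Finset.mem_range.2 (by norm_num : 0 < 5)))
  · exact Finset.le_sup' (fun n => ∑ j ∈ Finset.range 7, ((Nat.choose 6 j : ℕ) : ℝ) *
        Real.exp (-(β / 2 * ((kgp1x5_Tl2201x_c1_hl_mum91o10_sigma (j + n) : ℚ) : ℝ)))) (Finset.mem_range.2 (by omega))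

/-- **CORNER 2, entropy-resolved cap** at level -91/10 (every β ≥ 0): `P_cell ≤ log max_{n≤4} Σ_{j≤6} C(6,j)·e^{−(β/2)·q_2(j+n)}`, `q_2(k) = σ_2(k)` (the corner's own kgp1x5 table, §1)
(as β → ∞: `38.9833·β + log 15`, minimum in sector(s) k = [8]). [cite: PoulinHastings2011, eqs. (3)–(8)] [cite: Israel1979, Thm. I.2.4] -/
theorem emeryBoxTl2201K26_corner2_pressureCap_m91o10_markov {β : ℝ} (hβ : 0 ≤ β) :
    emeryCellPressure β (emeryLine cuprateSigns (tl2201K26Corner 2) + ((-91/10 : ℚ) : ℝ) • levelDir) ≤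
      Real.log ((Finset.range 5).sup' ⟨0, by simp⟩ fun n => ∑ j ∈ Finset.range 7, ((Nat.choose 6 j : ℕ) : ℝ) *
        Real.exp (-(β / 2 * ((kgp1x5_Tl2201x_c2_lh_mum91o10_sigma (j + n) : ℚ) : ℝ)))) := by
  rw [show ((-91/10 : ℚ) : ℝ) = (-91/10 : ℝ) by norm_num]
  refine emeryCellPressure_le_log_of_gpSectorFloors _ (M := 2) two_pos hβ _ tl2201K26Floor_table2 ?_ fun n hn => ?_
  · exact lt_of_lt_of_le (sum_choose_exp_pos' _) (Finset.le_sup' (fun n => ∑ j ∈ Finset.range 7, ((Nat.choose 6 j : ℕ) : ℝ) *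
        Real.exp (-(β / 2 * ((kgp1x5_Tl2201x_c2_lh_mum91o10_sigma (j + n) : ℚ) : ℝ)))) (Finset.mem_range.2 (by norm_num : 0 < 5)))
  · exact Finset.le_sup' (fun n => ∑ j ∈ Finset.range 7, ((Nat.choose 6 j : ℕ) : ℝ) *
        Real.exp (-(β / 2 * ((kgp1x5_Tl2201x_c2_lh_mum91o10_sigma (j + n) : ℚ) : ℝ)))) (Finset.mem_range.2 (by omega))

/-- **CORNER 3, entropy-resolved cap** at level -91/10 (every β ≥ 0): `P_cell ≤ log max_{n≤4} Σ_{j≤6} C(6,j)·e^{−(β/2)·q_3(j+n)}`, `q_3(k) = σ_3(k)` (the corner's own kgp1x5 table, §1)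
(as β → ∞: `38.9833·β + log 15`, minimum in sector(s) k = [8]). [cite: PoulinHastings2011, eqs. (3)–(8)] [cite: Israel1979, Thm. I.2.4] -/
theorem emeryBoxTl2201K26_corner3_pressureCap_m91o10_markov {β : ℝ} (hβ : 0 ≤ β) :
    emeryCellPressure β (emeryLine cuprateSigns (tl2201K26Corner 3) + ((-91/10 : ℚ) : ℝ) • levelDir) ≤
      Real.log ((Finset.range 5).sup' ⟨0, by simp⟩ fun n => ∑ j ∈ Finset.range 7, ((Nat.choose 6 j : ℕ) : ℝ) *
        Real.exp (-(β / 2 * ((kgp1x5_Tl2201x_c3_hh_mum91o10_sigma (j + n) : ℚ) : ℝ)))) := by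
  rw [show ((-91/10 : ℚ) : ℝ) = (-91/10 : ℝ) by norm_num]
  refine emeryCellPressure_le_log_of_gpSectorFloors _ (M := 2) two_pos hβ _ tl2201K26Floor_table3 ?_ fun n hn => ?_
  · exact lt_of_lt_of_le (sum_choose_exp_pos' _) (Finset.le_sup' (fun n => ∑ j ∈ Finset.range 7, ((Nat.choose 6 j : ℕ) : ℝ) *
        Real.exp (-(β / 2 * ((kgp1x5_Tl2201x_c3_hh_mum91o10_sigma (j + n) : ℚ) : ℝ)))) (Finset.mem_range.2 (by norm_num : 0 < 5)))
  · exact Finset.le_sup' (fun n => ∑ j ∈ Finset.range 7, ((Nat.choose 6 j : ℕ) : ℝ) *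
        Real.exp (-(β / 2 * ((kgp1x5_Tl2201x_c3_hh_mum91o10_sigma (j + n) : ℚ) : ℝ)))) (Finset.mem_range.2 (by omega))

/-! ## §3 The entropy-resolved box word -/

/-- **THE ENTROPY-RESOLVED `T > 0` CAP WORD on `emeryBoxTl2201K26`** (hypothesis-free, every β ≥ 0, every point, level εp = -91/10 ⇔ chemical potential `91/10` eV):
`P_cell(β) ≤ maxᵢ log Fᵢ(β)` with the four corner functions of §2 [as β → ∞: `38.9833·β + log 15` = `38.9833·β + 2.7081`; float table in the module
docstring] versus the flat word `38.9833·β + 4.1589` of hubbard-downfold-mod-4's `emeryBoxTl2201K26_pressureCap_m91o10` (all four corner tilts of this object equal the level εp = -91/10, so the sector-wise re-tilt of `EmeryThreeBandCuO4CertificateRetilt` is the identity here and is omitted). [cite: Israel1979, Thm. I.3.4] [cite: PoulinHastings2011, eqs. (3)–(8)] -/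
theorem emeryBoxTl2201K26_pressureCap_m91o10_markov {β : ℝ} (hβ : 0 ≤ β) :
    HoldsOn (fun p : EmeryCoord → ℝ =>
      emeryCellPressure β (emeryLine cuprateSigns (emeryLineCoords (((-91/10 : ℚ)) : ℝ) p)) ≤
        max (max
          (Real.log ((Finset.range 5).sup' ⟨0, by simp⟩ fun n => ∑ j ∈ Finset.range 7, ((Nat.choose 6 j : ℕ) : ℝ) *
        Real.exp (-(β / 2 * ((kgp1x5_Tl2201x_c0_ll_mum91o10_sigma (j + n) : ℚ) : ℝ)))))
          (Real.log ((Finset.range 5).sup' ⟨0, by simp⟩ fun n => ∑ j ∈ Finset.range 7, ((Nat.choose 6 j : ℕ) : ℝ) *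
        Real.exp (-(β / 2 * ((kgp1x5_Tl2201x_c1_hl_mum91o10_sigma (j + n) : ℚ) : ℝ))))))
          (max
          (Real.log ((Finset.range 5).sup' ⟨0, by simp⟩ fun n => ∑ j ∈ Finset.range 7, ((Nat.choose 6 j : ℕ) : ℝ) *
        Real.exp (-(β / 2 * ((kgp1x5_Tl2201x_c2_lh_mum91o10_sigma (j + n) : ℚ) : ℝ)))))
          (Real.log ((Finset.range 5).sup' ⟨0, by simp⟩ fun n => ∑ j ∈ Finset.range 7, ((Nat.choose 6 j : ℕ) : ℝ) *
        Real.exp (-(β / 2 * ((kgp1x5_Tl2201x_c3_hh_mum91o10_sigma (j + n) : ℚ) : ℝ)))))))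
      emeryBoxTl2201K26 := by
  refine holdsOn_emeryCellPressureCap_of_cornerCaps (E := emeryBoxTl2201K26) (eA := tl2201K26Emery_tpd) (eB := tl2201K26Emery_tpp) (eD := tl2201K26Emery_Delta) (eUd := tl2201K26Emery_Udd) (eUp := tl2201K26Emery_Upp) (by simp [emeryBoxTl2201K26, emeryBoxTl2201K26Src, Function.update]) (by simp [emeryBoxTl2201K26, emeryBoxTl2201K26Src, Function.update]) (Function.update_self _ _ _) (by simp [emeryBoxTl2201K26, emeryBoxTl2201K26Src, Function.update]) (by simp [emeryBoxTl2201K26, emeryBoxTl2201K26Src, Function.update]) cuprateSigns hβ fun i => ?_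
  rw [emeryLine_lowerCorner_level, tl2201K26_lowerCorner]
  fin_cases i
  · exact le_max_of_le_left (le_max_of_le_left (emeryBoxTl2201K26_corner0_pressureCap_m91o10_markov hβ))
  · exact le_max_of_le_left (le_max_of_le_right (emeryBoxTl2201K26_corner1_pressureCap_m91o10_markov hβ))
  · exact le_max_of_le_right (le_max_of_le_left (emeryBoxTl2201K26_corner2_pressureCap_m91o10_markov hβ))
  · exact le_max_of_le_right (le_max_of_le_right (emeryBoxTl2201K26_corner3_pressureCap_m91o10_markov hβ))

end Summit.Ventures.CertifiedManyBodySolver.Downfold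

end
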